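import Literature.NumberTheory.EllipticCurves.FunctionFieldPlacesHeightOneSpectrumProofs
import Literature.NumberTheory.EllipticCurves.FunctionFieldPlacesProductFormulaProofs
import Literature.NumberTheory.EllipticCurves.FunctionFieldPlacesFiniteResidueFieldProofs
import Literature.NumberTheory.EllipticCurves.KummerSelmerGroupFinite
import Mathlib.NumberTheory.ClassNumber.FunctionField
import Mathlib.GroupTheory.FiniteAbelian.Basic
import Mathlib.FieldTheory.RatFunc.AsPolynomial
import HarnessLib

/-!
# Finiteness of `F(S, d) ⊆ Fˣ/(Fˣ)ᵈ` for a global function field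
# (Lang, *Fundamentals of Diophantine Geometry*, Ch. 6, Thm. 1.4 and Cor. 1.5; Milne ADT I.4.15)

Fourth decomposition file (D-0014/D-0026, provefact seat on
`Literature.NumberTheory.EllipticCurves.FunctionField.finite_shaPrimeToChar_torsionBy`, statement
file `FunctionField`, bsd.S33) for the finiteness of `Ш(E/F)[n]` over a *global function field*
`F` (a finite extension of `𝔽_q(T)`). The arithmetic input of the finiteness of
`H¹(G_F, M; S)` (Silverman, *AEC*, Lemma X.4.3 / Prop. VIII.1.6; Milne, *ADT*, I.4.15) over `F`
is the finiteness of the group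

  `F(S, d) = {b ∈ Fˣ/(Fˣ)ᵈ | ord_v(b) ≡ 0 (mod d) for all places v ∉ S}`

for a finite set `S` of places and `d ≥ 1` — the group `B_u/K^{*m}` of Lang, *Fundamentals of
Diophantine Geometry*, Ch. 6 §1, Thm. 1.4, sitting in the exact sequence
`0 → U/U^m → B_u/K^{*m} → C_m → 0` (`U` the `M_K`-units, `C` the `M_K`-ideal classes), finite as
soon as `C_m` and `U/U^m` are (Cor. 1.5); for a number field this is the group `T_S = K(S, m)`
of Silverman's proof of Prop. VIII.1.6 (`NumberField.finite_selmerGroup` of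
`KummerSelmerGroupFinite`). This file **proves** the function-field case
(`finite_setOf_forall_dvd_ord`), entirely from Mathlib and the tree:

* choose a *separating* element `y` (`F/𝔽_q(y)` finite separable; the tree's
  `exists_pow_eq_and_isSeparable`, Stichtenoth III.10.2 / Rosen 7.4–7.5) and let
  `𝓞 = ringOfIntegers` be the integral closure of `𝔽_q[y]` (Mathlib's
  `FunctionField.ringOfIntegers`, a Dedekind domain with **finite class group**, Mathlib's
  `FunctionField.RingOfIntegers.instFintypeClassGroup`);
* the finite places (those with `y ∈ O_v`) are the localisations of `𝓞` at its height-one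
  primes, with matching normalised valuations (tree: `finitePlaceEquivHeightOneSpectrum`,
  `Place.valuation_eq_exp_neg_ord_of_val_eq`, Stichtenoth 3.2.6/3.2.9), and there are only
  finitely many infinite places (tree: `finite_setOf_not_isFinitePlace_holds`, Rosen Prop. 7.1);
* **the unit group `𝓞ˣ` is finitely generated** (`fg_units_ringOfIntegers`, the function-field
  `S`-unit theorem in its weak form, Rosen Prop. 14.2 / Lang Ch. 6 §1 "the units are merely the
  non-zero constants" over `k̄`): the divisor map `u ↦ (ord_v u)_{v ∤ y finite}` … more precisely
  `u ↦ (ord_v u)_{v infinite}` has values in the finitely generated group `ℤ^{#∞}` and finite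
  kernel — a unit with no zeros and poles is algebraic over `𝔽_q` (a transcendental element has
  a pole: zeros of a separating element count `[F : 𝔽_q(y)] > 0`, tree
  `Place.finite_zeros_and_finsum_eq_finrank`, Rosen Prop. 5.1), hence a root of unity, and roots
  of unity inject into a (finite, tree `Place.finite_residueField_holds`) residue field;
  so `𝓞ˣ/(𝓞ˣ)ᵈ` is finite (Mathlib `Subgroup.finiteIndex_range_powMonoidHom_of_fg`);
* hence `F(S', d)` is finite for every finite set `S'` of primes of `𝓞` (tree:
  `IsDedekindDomain.selmerGroup.finite_of_finite_classGroup`, the exact sequence of Lang's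
  Thm. 1.4 / Mathlib's `IsDedekindDomain.selmerGroup`), and `F(S, d)` embeds into `F(S', d)` for
  `S'` the primes whose place lies in `S` (the infinite places impose no condition in `F(S', d)`).

The statement is intrinsic to the field `F` (places are all discrete valuation rings of `F`,
`Place F`); the `𝔽_q(T)`-structure only witnesses that `F` is a global function field, and the
proof replaces it by a separable one.

## References

* [Lang1983] S. Lang, *Fundamentals of Diophantine Geometry*, Springer 1983, Ch. 6 §1,
  Prop. 1.3, Thm. 1.4, Cor. 1.5, Thm. 1.7 (pp. 123–124 of the held copy).
* [MilneADT2006] J. S. Milne, *Arithmetic Duality Theorems*, 2nd ed., I.§4 Cor. 4.15 (finiteness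
  of `H¹(G_S, M)` for global fields, function fields included).
* [SilvermanAEC2009] J. H. Silverman, *The Arithmetic of Elliptic Curves*, 2nd ed., proof of
  Prop. VIII.1.6 (the group `T_S`), Thm. X.1.1(c) (`K(S, m)`).
* [RosenFunctionFields2002] M. Rosen, *Number Theory in Function Fields*, Prop. 5.1, Prop. 7.1,
  Ch. 14 (`S`-units and `S`-class groups).
* [Stichtenoth2009] H. Stichtenoth, *Algebraic Function Fields and Codes*, I.1.15, I.3.4,
  III.2.6/3.2.9, III.10.2.

## Mathlib / tree reuse

Mathlib: `FunctionField.ringOfIntegers` (+ `IsDedekindDomain`, `IsFractionRing`,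
`Fintype (ClassGroup _)` under `Algebra.IsSeparable (RatFunc Fq) F`),
`RatFunc.algEquivOfTranscendental`, `RatFunc.transcendental_X`, `IsDedekindDomain.selmerGroup`,
`Subgroup.finiteIndex_range_powMonoidHom_of_fg`, `Submodule.fg_of_fg_map_of_fg_inf_ker`,
`Module.Finite.iff_addGroup_fg`, `GroupFG.iff_add_fg`, `Ring.not_isField_iff_exists_prime`.
Tree: `exists_pow_eq_and_isSeparable`, `finiteDimensional_adjoin_simple_of_transcendental`,
`essFiniteType_of_ratFunc`, `trdeg_eq_one_of_ratFunc`, `Place.finite_zeros_and_finsum_eq_finrank`,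
`Place.ord_mul/ord_pow/ord_inv/ord_eq_zero_iff/ord_eq_zero_of_pow_eq_one`,
`Place.valuation_eq_exp_neg_ord_of_val_eq` (`FunctionFieldPlacesProductFormulaProofs`);
`finitePlaceOfPrime`, `finitePlaceEquivHeightOneSpectrum`, `isFinitePlace_iff_X_mem`
(`FunctionFieldPlacesHeightOneSpectrumProofs`); `FinitePlacesOfDegree.coe_mem`
(`FunctionFieldPlaceDegreesProofs`); `finite_setOf_not_isFinitePlace_holds` (`FunctionFieldPlaces`);
`Place.finite_residueField_holds` (`FunctionFieldPlacesFiniteResidueFieldProofs`);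
`IsDedekindDomain.selmerGroup.finite_of_finite_classGroup`, `IsDedekindDomain.mk_mem_selmerGroup_iff`
(`KummerSelmerGroupFinite`).

## Design choices

* `noncomputable section`, `open scoped Classical`, `Fq F : Type` (universe `0`, forced by
  `Place F`); everything in `namespace Literature.NumberTheory.EllipticCurves.FunctionField`.
* No definition is introduced: `F(S, d)` is written as the subset
  `{x | ∃ a : Fˣ, ↑a = x ∧ ∀ v ∉ S, (d : ℤ) ∣ ord_v a}` of `Fˣ ⧸ (powMonoidHom d).range`
  (the ambient group of Mathlib's `IsDedekindDomain.selmerGroup`), with the tree's normalised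
  `Place.ord : F → ℤ`.
* No `def … : Prop` (named fact) is introduced (D-0026); every statement is a proved theorem.
-/

noncomputable section

open scoped Classical Polynomial IntermediateField

namespace Literature.NumberTheory.EllipticCurves.FunctionField

open IsDedekindDomain

/-! ## Algebraic elements are roots of unity; transcendental elements have poles -/

section Poles

variable {Fq : Type} [Field Fq] [Fintype Fq] {F : Type} [Field F] [Algebra Fq F]

/-- A nonzero element of `F` algebraic over the finite field `𝔽_q` is a root of unity
(`𝔽_q(x)` is a finite field). [folklore] -/
theorem exists_pow_eq_one_of_isAlgebraic {x : F} (hx : IsAlgebraic Fq x) (hx0 : x ≠ 0) :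
    ∃ n : ℕ, 0 < n ∧ x ^ n = 1 := by
  haveI : FiniteDimensional Fq Fq⟮x⟯ := IntermediateField.adjoin.finiteDimensional hx.isIntegral
  haveI : Finite Fq⟮x⟯ := Module.finite_of_finite Fq
  letI : Fintype Fq⟮x⟯ := Fintype.ofFinite _
  set x' : Fq⟮x⟯ := ⟨x, IntermediateField.mem_adjoin_simple_self Fq x⟩ with hx'_def
  have hx' : x' ≠ 0 := fun h => hx0 (congrArg Subtype.val h)
  refine ⟨Fintype.card Fq⟮x⟯ - 1, ?_, ?_⟩
  · have := Fintype.one_lt_card (α := Fq⟮x⟯)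
    omega
  · have h := congrArg Subtype.val (FiniteField.pow_card_sub_one_eq_one x' hx')
    simpa using h

/-- **A transcendental element of a one-variable function field over `𝔽_q` has a zero**
(Rosen, Prop. 5.1: `deg (x)_0 = [F : 𝔽_q(x)] > 0`): write `x = y ^ (p ^ e)` with `F/𝔽_q(y)`
separable (`exists_pow_eq_and_isSeparable`); the zeros of `y`, counted with degrees, number
`[F : 𝔽_q(y)] > 0` (`Place.finite_zeros_and_finsum_eq_finrank`), and `ord_v x = p ^ e · ord_v y`.
[cite: RosenFunctionFields2002, Prop. 5.1] -/
theorem exists_ord_pos_of_transcendental (p : ℕ) [Fact p.Prime] [CharP F p]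
    [Algebra.EssFiniteType Fq F] (h1 : Algebra.trdeg Fq F = 1) {x : F}
    (hx : Transcendental Fq x) : ∃ v : Place F, 0 < v.ord x := by
  obtain ⟨y, e, rfl, hyt, hsep⟩ := exists_pow_eq_and_isSeparable Fq p h1 hx
  haveI := finiteDimensional_adjoin_simple_of_transcendental Fq h1 hyt
  haveI := hsep
  obtain ⟨-, hsum⟩ := Place.finite_zeros_and_finsum_eq_finrank (Fq := Fq) y hyt
  have hpos : 0 < Module.finrank Fq⟮y⟯ F := Module.finrank_pos
  by_contra hno
  push Not at hno
  have hpe : (0 : ℤ) < ((p ^ e : ℕ) : ℤ) := by exact_mod_cast pow_pos (Fact.out : p.Prime).pos e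
  have hempty : {v : Place F | 0 < v.ord y} = ∅ := by
    ext v
    simp only [Set.mem_setOf_eq, Set.mem_empty_iff_false, iff_false, not_lt]
    have hv := hno v
    rw [Place.ord_pow] at hv
    by_contra hy
    push Not at hy
    exact absurd hv (not_le.mpr (mul_pos hpe hy))
  rw [hempty, finsum_mem_empty] at hsum
  have h0 : Module.finrank Fq⟮y⟯ F = 0 := by exact_mod_cast hsum.symm
  exact hpos.ne' h0

/-- A transcendental element of a one-variable function field over `𝔽_q` has a pole (a zero of
`x⁻¹`). Rosen, Prop. 5.1. [cite: RosenFunctionFields2002, Prop. 5.1] -/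
theorem exists_ord_lt_zero_of_transcendental (p : ℕ) [Fact p.Prime] [CharP F p]
    [Algebra.EssFiniteType Fq F] (h1 : Algebra.trdeg Fq F = 1) {x : F}
    (hx : Transcendental Fq x) : ∃ v : Place F, v.ord x < 0 := by
  have hxi : Transcendental Fq x⁻¹ := fun h => hx (by simpa using h.inv)
  obtain ⟨v, hv⟩ := exists_ord_pos_of_transcendental (Fq := Fq) p h1 hxi
  refine ⟨v, ?_⟩
  rw [Place.ord_inv] at hv
  omega

/-- An element without poles (and zeros) is algebraic over `𝔽_q` (Rosen, Prop. 5.1: a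
non-constant function has a pole). [cite: RosenFunctionFields2002, Prop. 5.1] -/
theorem isAlgebraic_of_forall_ord_eq_zero (p : ℕ) [Fact p.Prime] [CharP F p]
    [Algebra.EssFiniteType Fq F] (h1 : Algebra.trdeg Fq F = 1) {x : F}
    (h : ∀ v : Place F, v.ord x = 0) : IsAlgebraic Fq x := by
  by_contra hx
  obtain ⟨v, hv⟩ := exists_ord_lt_zero_of_transcendental (Fq := Fq) p h1 hx
  exact absurd (h v) hv.ne

end Poles

/-! ## The interface to `FunctionField Fq F` -/

section Interface

variable (Fq : Type) [Field Fq] [Fintype Fq] {F : Type} [Field F] [Algebra Fq[X] F]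
  [Algebra (RatFunc Fq) F] [IsScalarTower Fq[X] (RatFunc Fq) F] [FunctionField Fq F]

include Fq

/-- **In a global function field an element with neither zeros nor poles is a root of unity**
(Rosen, Prop. 5.1 with Ch. 5, p. 49: such an element is a constant, and the constant field is
finite). The constant field acts through `𝔽_q[T] → F`, installed locally as in
`Place.finite_setOf_ord_ne_zero`. [cite: RosenFunctionFields2002, Prop. 5.1] -/
theorem exists_pow_eq_one_of_forall_ord_eq_zero {x : F} (hx0 : x ≠ 0)
    (h : ∀ v : Place F, v.ord x = 0) : ∃ n : ℕ, 0 < n ∧ x ^ n = 1 := by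
  letI : Algebra Fq F := ((algebraMap Fq[X] F).comp Polynomial.C).toAlgebra
  haveI : IsScalarTower Fq (RatFunc Fq) F := IsScalarTower.of_algebraMap_eq fun c => by
    rw [IsScalarTower.algebraMap_apply Fq Fq[X] (RatFunc Fq) c, Polynomial.algebraMap_eq,
      ← IsScalarTower.algebraMap_apply Fq[X] (RatFunc Fq) F (Polynomial.C c)]
    rfl
  haveI : Algebra.EssFiniteType Fq F := essFiniteType_of_ratFunc Fq F
  have h1 : Algebra.trdeg Fq F = 1 := trdeg_eq_one_of_ratFunc Fq F
  obtain ⟨p, hchar⟩ := CharP.exists Fq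
  have hp : p.Prime := CharP.char_is_prime Fq p
  haveI : Fact p.Prime := ⟨hp⟩
  haveI : CharP F p := charP_of_injective_algebraMap (algebraMap Fq F).injective p
  exact exists_pow_eq_one_of_isAlgebraic (isAlgebraic_of_forall_ord_eq_zero p h1 h) hx0

/-- If `x` has neither zeros nor poles then neither has `x - 1`, unless `x = 1` (both `x` and
`x - 1` are algebraic over `𝔽_q`, i.e. roots of unity or zero). [folklore] -/
theorem forall_ord_sub_one_eq_zero {x : F} (h : ∀ v : Place F, v.ord x = 0) (h1 : x - 1 ≠ 0)
    (v : Place F) : v.ord (x - 1) = 0 := by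
  letI : Algebra Fq F := ((algebraMap Fq[X] F).comp Polynomial.C).toAlgebra
  haveI : IsScalarTower Fq (RatFunc Fq) F := IsScalarTower.of_algebraMap_eq fun c => by
    rw [IsScalarTower.algebraMap_apply Fq Fq[X] (RatFunc Fq) c, Polynomial.algebraMap_eq,
      ← IsScalarTower.algebraMap_apply Fq[X] (RatFunc Fq) F (Polynomial.C c)]
    rfl
  haveI : Algebra.EssFiniteType Fq F := essFiniteType_of_ratFunc Fq F
  have htr : Algebra.trdeg Fq F = 1 := trdeg_eq_one_of_ratFunc Fq F
  obtain ⟨p, hchar⟩ := CharP.exists Fq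
  have hp : p.Prime := CharP.char_is_prime Fq p
  haveI : Fact p.Prime := ⟨hp⟩
  haveI : CharP F p := charP_of_injective_algebraMap (algebraMap Fq F).injective p
  have halg : IsAlgebraic Fq x := isAlgebraic_of_forall_ord_eq_zero p htr h
  have halg' : IsAlgebraic Fq (x - 1) := by
    rw [isAlgebraic_iff_isIntegral] at halg ⊢
    exact halg.sub isIntegral_one
  obtain ⟨n, hn, hpow⟩ := exists_pow_eq_one_of_isAlgebraic halg' h1
  exact v.ord_eq_zero_of_pow_eq_one hn hpow

omit [Fintype Fq] [FunctionField Fq F] in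
/-- `T ∈ F` is transcendental over `𝔽_q` (the structure map `𝔽_q(T) → F` is injective).
[folklore] -/
theorem transcendental_algebraMap_ratFuncX :
    letI : Algebra Fq F := ((algebraMap Fq[X] F).comp Polynomial.C).toAlgebra
    Transcendental Fq (algebraMap (RatFunc Fq) F RatFunc.X) := by
  letI : Algebra Fq F := ((algebraMap Fq[X] F).comp Polynomial.C).toAlgebra
  haveI : IsScalarTower Fq (RatFunc Fq) F := IsScalarTower.of_algebraMap_eq fun c => by
    rw [IsScalarTower.algebraMap_apply Fq Fq[X] (RatFunc Fq) c, Polynomial.algebraMap_eq,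
      ← IsScalarTower.algebraMap_apply Fq[X] (RatFunc Fq) F (Polynomial.C c)]
    rfl
  rw [transcendental_algebraMap_iff (algebraMap (RatFunc Fq) F).injective]
  exact RatFunc.transcendental_X

end Interface

/-! ## Units of the ring of integers of a separable model -/

section Units

variable (Fq : Type) [Field Fq] [Fintype Fq] {F : Type} [Field F] [Algebra Fq[X] F]
  [Algebra (RatFunc Fq) F] [IsScalarTower Fq[X] (RatFunc Fq) F] [FunctionField Fq F]

omit [FunctionField Fq F] in
/-- A unit of `𝓞 = ringOfIntegers Fq F` has `ord_v = 0` at every finite place `v` (`𝓞 ⊆ O_v`,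
so the unit and its inverse are `v`-integral). Rosen, Ch. 14 (the `S`-units are the units of the
ring of `S`-integers). [folklore] -/
theorem ord_unit_eq_zero_of_isFinitePlace (u : (_root_.FunctionField.ringOfIntegers Fq F)ˣ)
    {v : Place F} (hv : IsFinitePlace Fq v) :
    v.ord (((u : _root_.FunctionField.ringOfIntegers Fq F) : F)) = 0 := by
  have hX := (isFinitePlace_iff_X_mem Fq v).mp hv
  have hu : ((u : _root_.FunctionField.ringOfIntegers Fq F) : F) ∈ v.1 :=
    FinitePlacesOfDegree.coe_mem v.1 hX (u : _root_.FunctionField.ringOfIntegers Fq F)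
  have hu' : (((u⁻¹ : (_root_.FunctionField.ringOfIntegers Fq F)ˣ) :
      _root_.FunctionField.ringOfIntegers Fq F) : F) ∈ v.1 :=
    FinitePlacesOfDegree.coe_mem v.1 hX _
  have h0 : ((u : _root_.FunctionField.ringOfIntegers Fq F) : F) ≠ 0 := fun h =>
    u.ne_zero (Subtype.ext h)
  have hinv : (((u⁻¹ : (_root_.FunctionField.ringOfIntegers Fq F)ˣ) :
      _root_.FunctionField.ringOfIntegers Fq F) : F) =
      ((u : _root_.FunctionField.ringOfIntegers Fq F) : F)⁻¹ := by
    apply eq_inv_of_mul_eq_one_left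
    have := congrArg (fun z : _root_.FunctionField.ringOfIntegers Fq F => (z : F)) u.inv_mul
    simp only [MulMemClass.coe_mul, OneMemClass.coe_one] at this
    exact this
  rw [hinv] at hu'
  exact (v.ord_eq_zero_iff h0).2 ⟨hu, hu'⟩

variable [Algebra.IsSeparable (RatFunc Fq) F]

include Fq in
/-- **The unit group of the ring of integers of a global function field (w.r.t. a separating
`T`) is finitely generated** — the weak form of the function-field `S`-unit theorem for `S` the
set of infinite places (Rosen, Prop. 14.2; Lang, *FDG*, Ch. 6 §1, the group `U` of Thm. 1.4).
Proof: the map `u ↦ (ord_v u)_{v infinite}` into the finitely generated group `ℤ^{#∞}`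
(finitely many infinite places, `finite_setOf_not_isFinitePlace_holds`) is additive, and its
kernel consists of units without zeros and poles (`ord_unit_eq_zero_of_isFinitePlace` at the
finite places), which are roots of unity (`exists_pow_eq_one_of_forall_ord_eq_zero`) and inject
into the finite residue field of any place (`Place.finite_residueField_holds`): two such units
with the same residue have a quotient `w` with `w - 1` in the maximal ideal, and `w - 1 ≠ 0`
would again be a unit there (`forall_ord_sub_one_eq_zero`). A `ℤ`-module with finitely
generated image and finite kernel is finitely generated (`Submodule.fg_of_fg_map_of_fg_inf_ker`).
[cite: Lang1983, Ch. 6 Thm. 1.4 (the group U)] -/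
theorem fg_units_ringOfIntegers : Group.FG (_root_.FunctionField.ringOfIntegers Fq F)ˣ := by
  classical
  -- ### the infinite places
  have hT : {v : Place F | ¬ IsFinitePlace Fq v}.Finite := finite_setOf_not_isFinitePlace_holds Fq F
  haveI : Finite {v : Place F | ¬ IsFinitePlace Fq v} := hT.to_subtype
  have hord1 : ∀ v : Place F, v.ord (1 : F) = 0 := fun v =>
    v.ord_eq_zero_of_pow_eq_one one_pos (one_pow 1)
  have hne : ∀ u : (_root_.FunctionField.ringOfIntegers Fq F)ˣ,
      ((u : _root_.FunctionField.ringOfIntegers Fq F) : F) ≠ 0 := fun u h =>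
    u.ne_zero (Subtype.ext h)
  -- ### the divisor map at infinity
  let φ : Additive (_root_.FunctionField.ringOfIntegers Fq F)ˣ →+
      ({v : Place F | ¬ IsFinitePlace Fq v} → ℤ) :=
    { toFun := fun u v => (v : Place F).ord
        (((Additive.toMul u : (_root_.FunctionField.ringOfIntegers Fq F)ˣ) :
          _root_.FunctionField.ringOfIntegers Fq F) : F)
      map_zero' := by
        funext v
        simp [hord1]
      map_add' := fun a b => by
        funext v
        simp only [Pi.add_apply, toMul_add, Units.val_mul, MulMemClass.coe_mul]
        exact (v : Place F).ord_mul (hne _) (hne _) }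
  have hφ : ∀ u : (_root_.FunctionField.ringOfIntegers Fq F)ˣ, φ (Additive.ofMul u) = 0 →
      ∀ v : Place F, v.ord ((u : _root_.FunctionField.ringOfIntegers Fq F) : F) = 0 := by
    intro u hu v
    by_cases hv : IsFinitePlace Fq v
    · exact ord_unit_eq_zero_of_isFinitePlace Fq u hv
    · exact congr_fun hu ⟨v, hv⟩
  -- ### a (finite) place and its finite residue field
  obtain ⟨p, hp0, hp⟩ := Ring.not_isField_iff_exists_prime.mp
    (_root_.FunctionField.ringOfIntegers.not_isField Fq F)
  let 𝔭 : HeightOneSpectrum (_root_.FunctionField.ringOfIntegers Fq F) := ⟨p, hp, hp0⟩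
  let v₀ : Place F := (finitePlaceOfPrime Fq 𝔭).1
  have hv₀ : IsFinitePlace Fq v₀ := (finitePlaceOfPrime Fq 𝔭).2
  have hX := (isFinitePlace_iff_X_mem Fq v₀).mp hv₀
  have hmem : ∀ b : _root_.FunctionField.ringOfIntegers Fq F, (b : F) ∈ v₀.1 := fun b =>
    FinitePlacesOfDegree.coe_mem v₀.1 hX b
  haveI : Finite (IsLocalRing.ResidueField v₀.1) := Place.finite_residueField_holds Fq v₀
  let ρ : Additive (_root_.FunctionField.ringOfIntegers Fq F)ˣ → IsLocalRing.ResidueField v₀.1 :=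
    fun u => IsLocalRing.residue v₀.1
      ⟨(((Additive.toMul u : (_root_.FunctionField.ringOfIntegers Fq F)ˣ) :
        _root_.FunctionField.ringOfIntegers Fq F) : F), hmem _⟩
  -- ### the kernel is finite
  have hker : ((LinearMap.ker φ.toIntLinearMap : Submodule ℤ _) : Set (Additive
      (_root_.FunctionField.ringOfIntegers Fq F)ˣ)).Finite := by
    refine Set.Finite.of_finite_image (f := ρ) (Set.toFinite _) ?_
    intro u hu u' hu' hρ
    rw [SetLike.mem_coe, LinearMap.mem_ker] at hu hu'
    set a : (_root_.FunctionField.ringOfIntegers Fq F)ˣ := Additive.toMul u with ha_def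
    set b : (_root_.FunctionField.ringOfIntegers Fq F)ˣ := Additive.toMul u' with hb_def
    have ha : ∀ v : Place F, v.ord ((a : _root_.FunctionField.ringOfIntegers Fq F) : F) = 0 :=
      hφ a hu
    have hb : ∀ v : Place F, v.ord ((b : _root_.FunctionField.ringOfIntegers Fq F) : F) = 0 :=
      hφ b hu'
    set α : F := ((a : _root_.FunctionField.ringOfIntegers Fq F) : F) with hα_def
    set β : F := ((b : _root_.FunctionField.ringOfIntegers Fq F) : F) with hβ_def
    have hα0 : α ≠ 0 := hne a
    have hβ0 : β ≠ 0 := hne b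
    -- `γ = α / β` has neither zeros nor poles
    have hγ : ∀ v : Place F, v.ord (α * β⁻¹) = 0 := fun v => by
      rw [v.ord_mul hα0 (inv_ne_zero hβ0), Place.ord_inv, ha v, hb v, neg_zero, add_zero]
    -- `α ≡ β` modulo `𝔪_{v₀}`
    have hαβ : (⟨α, hmem _⟩ - ⟨β, hmem _⟩ : v₀.1) ∈ IsLocalRing.maximalIdeal v₀.1 :=
      Ideal.Quotient.eq.mp hρ
    have hβinv : β⁻¹ ∈ v₀.1 := ((v₀.ord_eq_zero_iff hβ0).1 (hb v₀)).2
    have hγ1 : (⟨α * β⁻¹ - 1, sub_mem (mul_mem (hmem _) hβinv) (one_mem _)⟩ : v₀.1) ∈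
        IsLocalRing.maximalIdeal v₀.1 := by
      have h := Ideal.mul_mem_left _ (⟨β⁻¹, hβinv⟩ : v₀.1) hαβ
      convert h using 1
      apply Subtype.ext
      change α * β⁻¹ - 1 = β⁻¹ * (α - β)
      rw [mul_sub, inv_mul_cancel₀ hβ0, mul_comm]
    -- hence `γ = 1`
    have hγeq : α * β⁻¹ - 1 = 0 := by
      by_contra hne1
      have hord : v₀.ord (α * β⁻¹ - 1) = 0 := forall_ord_sub_one_eq_zero Fq hγ hne1 v₀
      have hinvmem : (α * β⁻¹ - 1)⁻¹ ∈ v₀.1 := ((v₀.ord_eq_zero_iff hne1).1 hord).2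
      have hunit : IsUnit (⟨α * β⁻¹ - 1, sub_mem (mul_mem (hmem _) hβinv) (one_mem _)⟩ : v₀.1) :=
        isUnit_iff_exists_inv.2 ⟨⟨_, hinvmem⟩, Subtype.ext (mul_inv_cancel₀ hne1)⟩
      exact (IsLocalRing.mem_maximalIdeal _).mp hγ1 hunit
    have hab : α = β := by
      rwa [sub_eq_zero, mul_inv_eq_one₀ hβ0] at hγeq
    have hab' : a = b := Units.ext (Subtype.ext hab)
    change Additive.ofMul a = Additive.ofMul b
    rw [hab']
  -- ### finite generation
  have hfg : (⊤ : Submodule ℤ (Additive (_root_.FunctionField.ringOfIntegers Fq F)ˣ)).FG := by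
    refine Submodule.fg_of_fg_map_of_fg_inf_ker φ.toIntLinearMap ?_ ?_
    · exact IsNoetherian.noetherian _
    · rw [top_inf_eq]
      exact Submodule.fg_def.mpr ⟨_, hker, Submodule.span_eq _⟩
  have hmf : Module.Finite ℤ (Additive (_root_.FunctionField.ringOfIntegers Fq F)ˣ) := ⟨hfg⟩
  exact GroupFG.iff_add_fg.mpr (Module.Finite.iff_addGroup_fg.mp hmf)

include Fq in
/-- Consequently `𝓞ˣ/(𝓞ˣ)ᵈ` is finite for `d ≥ 1` (the group `U/U^m` of Lang, *FDG*, Ch. 6,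
Thm. 1.4 / Cor. 1.5, function-field case). [cite: Lang1983, Ch. 6 Cor. 1.5] -/
theorem finite_quotient_units_range_powMonoidHom {d : ℕ} (hd : 0 < d) :
    Finite ((_root_.FunctionField.ringOfIntegers Fq F)ˣ ⧸
      (powMonoidHom d : (_root_.FunctionField.ringOfIntegers Fq F)ˣ →*
        (_root_.FunctionField.ringOfIntegers Fq F)ˣ).range) := by
  haveI := fg_units_ringOfIntegers Fq (F := F)
  haveI := Subgroup.finiteIndex_range_powMonoidHom_of_fg
    (_root_.FunctionField.ringOfIntegers Fq F)ˣ hd.ne'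
  exact Subgroup.finiteIndex_iff_finite_quotient.mp ‹_›

end Units

/-! ## Finiteness of `F(S, d)` -/

section Separable

variable (Fq : Type) [Field Fq] [Fintype Fq] {F : Type} [Field F] [Algebra Fq[X] F]
  [Algebra (RatFunc Fq) F] [IsScalarTower Fq[X] (RatFunc Fq) F] [FunctionField Fq F]
  [Algebra.IsSeparable (RatFunc Fq) F]

include Fq in
/-- **`F(S, d)` is finite, separable model** (Lang, *FDG*, Ch. 6, Thm. 1.4 with Cor. 1.5, for
the global function field `F` and `M_K` = the finite places w.r.t. a separating `T`): for a
finite set `S` of places and `d ≥ 1`, the set of classes `b ∈ Fˣ/(Fˣ)ᵈ` with `d ∣ ord_v(b)`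
for all `v ∉ S` is finite. It embeds into Mathlib's `F⟮S', d⟯` for the Dedekind domain
`𝓞 = ringOfIntegers Fq F` and the finite set `S'` of primes of `𝓞` whose place
(`finitePlaceOfPrime`) lies in `S` (`ord_v = ord_𝔭` there, `Place.valuation_eq_exp_neg_ord_of_val_eq`),
which is finite by the finiteness of the class group (Mathlib) and of `𝓞ˣ/(𝓞ˣ)ᵈ`
(`finite_quotient_units_range_powMonoidHom`) through
`IsDedekindDomain.selmerGroup.finite_of_finite_classGroup`. [cite: Lang1983, Ch. 6 Thm. 1.4 and Cor. 1.5] -/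
theorem finite_setOf_forall_dvd_ord_of_isSeparable {d : ℕ} (hd : 0 < d) {S : Set (Place F)}
    (hS : S.Finite) :
    {x : Fˣ ⧸ (powMonoidHom d : Fˣ →* Fˣ).range |
      ∃ a : Fˣ, (QuotientGroup.mk a : Fˣ ⧸ (powMonoidHom d : Fˣ →* Fˣ).range) = x ∧
        ∀ v : Place F, v ∉ S → (d : ℤ) ∣ v.ord (a : F)}.Finite := by
  classical
  let pl : HeightOneSpectrum (_root_.FunctionField.ringOfIntegers Fq F) → Place F :=
    fun 𝔭 => (finitePlaceOfPrime Fq 𝔭).1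
  have hpl : Function.Injective pl :=
    Subtype.val_injective.comp (finitePlaceEquivHeightOneSpectrum Fq (F := F)).symm.injective
  let S' : Set (HeightOneSpectrum (_root_.FunctionField.ringOfIntegers Fq F)) := pl ⁻¹' S
  have hS' : S'.Finite := hS.preimage hpl.injOn
  have hfin : Finite (selmerGroup (K := F) (S := S') (n := d)) :=
    selmerGroup.finite_of_finite_classGroup hS' hd
      (finite_quotient_units_range_powMonoidHom Fq (F := F) hd)
  have hset : ((selmerGroup (K := F) (S := S') (n := d) :
      Subgroup (Fˣ ⧸ (powMonoidHom d : Fˣ →* Fˣ).range)) :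
        Set (Fˣ ⧸ (powMonoidHom d : Fˣ →* Fˣ).range)).Finite :=
    Set.finite_coe_iff.mp hfin
  refine hset.subset ?_
  rintro x ⟨a, rfl, ha⟩
  rw [SetLike.mem_coe, IsDedekindDomain.mk_mem_selmerGroup_iff]
  intro 𝔭 h𝔭
  have hv : pl 𝔭 ∉ S := h𝔭
  have ha0 : ((a : F)) ≠ 0 := a.ne_zero
  rw [Place.valuation_eq_exp_neg_ord_of_val_eq 𝔭 (w := pl 𝔭) rfl ha0, WithZero.log_exp]
  exact (dvd_neg).mpr (ha (pl 𝔭) hv)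

end Separable

section Generator

variable (Fq : Type) [Field Fq] [Fintype Fq] {F : Type} [Field F] [Algebra Fq F]

include Fq in
/-- `F(S, d)` is finite for a one-variable function field `F/𝔽_q` presented by a separating
element `y` (`F/𝔽_q(y)` finite separable): transport of
`finite_setOf_forall_dvd_ord_of_isSeparable` along `𝔽_q(X) ≅ 𝔽_q(y)`
(`RatFunc.algEquivOfTranscendental`). [cite: Lang1983, Ch. 6 Thm. 1.4 and Cor. 1.5] -/
theorem finite_setOf_forall_dvd_ord_of_generator (y : F) (hy : Transcendental Fq y)
    [FiniteDimensional Fq⟮y⟯ F] [Algebra.IsSeparable Fq⟮y⟯ F] {d : ℕ} (hd : 0 < d)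
    {S : Set (Place F)} (hS : S.Finite) :
    {x : Fˣ ⧸ (powMonoidHom d : Fˣ →* Fˣ).range |
      ∃ a : Fˣ, (QuotientGroup.mk a : Fˣ ⧸ (powMonoidHom d : Fˣ →* Fˣ).range) = x ∧
        ∀ v : Place F, v ∉ S → (d : ℤ) ∣ v.ord (a : F)}.Finite := by
  let e : RatFunc Fq ≃ₐ[Fq] Fq⟮y⟯ := RatFunc.algEquivOfTranscendental y hy
  letI : Algebra (RatFunc Fq) Fq⟮y⟯ := (e : RatFunc Fq →ₐ[Fq] Fq⟮y⟯).toRingHom.toAlgebra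
  letI : Algebra (RatFunc Fq) F :=
    ((algebraMap Fq⟮y⟯ F).comp (e : RatFunc Fq →ₐ[Fq] Fq⟮y⟯).toRingHom).toAlgebra
  letI : Algebra Fq[X] F :=
    ((algebraMap (RatFunc Fq) F).comp (algebraMap Fq[X] (RatFunc Fq))).toAlgebra
  haveI : IsScalarTower Fq[X] (RatFunc Fq) F := IsScalarTower.of_algebraMap_eq fun _ => rfl
  haveI : IsScalarTower (RatFunc Fq) Fq⟮y⟯ F := IsScalarTower.of_algebraMap_eq fun _ => rfl
  haveI : Module.Finite (RatFunc Fq) Fq⟮y⟯ :=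
    Module.Finite.of_surjective (Algebra.linearMap (RatFunc Fq) Fq⟮y⟯) e.surjective
  haveI : FunctionField Fq F := Module.Finite.trans Fq⟮y⟯ F
  haveI : Algebra.IsSeparable (RatFunc Fq) Fq⟮y⟯ :=
    ⟨fun x => by
      obtain ⟨r, rfl⟩ := e.surjective x
      exact isSeparable_algebraMap r⟩
  haveI : Algebra.IsSeparable (RatFunc Fq) F := Algebra.IsSeparable.trans (RatFunc Fq) Fq⟮y⟯ F
  exact finite_setOf_forall_dvd_ord_of_isSeparable Fq hd hS

end Generator

section Main

variable (Fq : Type) [Field Fq] [Fintype Fq] {F : Type} [Field F] [Algebra Fq[X] F]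
  [Algebra (RatFunc Fq) F] [IsScalarTower Fq[X] (RatFunc Fq) F] [FunctionField Fq F]

include Fq in
/-- **`F(S, d)` is finite for a global function field** (Lang, *Fundamentals of Diophantine
Geometry*, Ch. 6, Thm. 1.4 and Cor. 1.5 — the exact sequence
`0 → U/U^m → B_u/K^{*m} → C_m → 0` with finite class group and finitely generated units; Milne,
*ADT*, I.4.15; the function-field counterpart of Silverman's `T_S = K(S, m)`, proof of
Prop. VIII.1.6). For a finite extension `F` of `𝔽_q(T)`, a finite set `S` of places of `F` and
`d ≥ 1`, the set of classes `b ∈ Fˣ/(Fˣ)ᵈ` with `ord_v(b) ≡ 0 (mod d)` for all places `v ∉ S`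
is finite. Proof: `T = y ^ (p ^ e)` with `y` separating (`exists_pow_eq_and_isSeparable`), and
`finite_setOf_forall_dvd_ord_of_generator`. The statement does not depend on the
`𝔽_q(T)`-structure. [cite: Lang1983, Ch. 6 Thm. 1.4 and Cor. 1.5] -/
theorem finite_setOf_forall_dvd_ord {d : ℕ} (hd : 0 < d) {S : Set (Place F)} (hS : S.Finite) :
    {x : Fˣ ⧸ (powMonoidHom d : Fˣ →* Fˣ).range |
      ∃ a : Fˣ, (QuotientGroup.mk a : Fˣ ⧸ (powMonoidHom d : Fˣ →* Fˣ).range) = x ∧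
        ∀ v : Place F, v ∉ S → (d : ℤ) ∣ v.ord (a : F)}.Finite := by
  have ht := transcendental_algebraMap_ratFuncX Fq (F := F)
  letI : Algebra Fq F := ((algebraMap Fq[X] F).comp Polynomial.C).toAlgebra
  haveI : IsScalarTower Fq (RatFunc Fq) F := IsScalarTower.of_algebraMap_eq fun c => by
    rw [IsScalarTower.algebraMap_apply Fq Fq[X] (RatFunc Fq) c, Polynomial.algebraMap_eq,
      ← IsScalarTower.algebraMap_apply Fq[X] (RatFunc Fq) F (Polynomial.C c)]
    rfl
  haveI : Algebra.EssFiniteType Fq F := essFiniteType_of_ratFunc Fq F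
  have h1 : Algebra.trdeg Fq F = 1 := trdeg_eq_one_of_ratFunc Fq F
  obtain ⟨p, hchar⟩ := CharP.exists Fq
  have hp : p.Prime := CharP.char_is_prime Fq p
  haveI : Fact p.Prime := ⟨hp⟩
  haveI : CharP F p := charP_of_injective_algebraMap (algebraMap Fq F).injective p
  obtain ⟨y, e, -, hyt, hsep⟩ := exists_pow_eq_and_isSeparable Fq p h1 ht
  haveI := finiteDimensional_adjoin_simple_of_transcendental Fq h1 hyt
  haveI := hsep
  exact finite_setOf_forall_dvd_ord_of_generator Fq y hyt hd hS

end Main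

end Literature.NumberTheory.EllipticCurves.FunctionField

end
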